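/-
Copyright (c) 2026 the pub-hodgecm-mathlib formalisation cell (harness21).  Prover seat hodgecm-mathlib-F0P3a-p09 (g8): line LH3 (closer stub `stub_N9`), LETTER L1 clause (I₁),
organ O-L1d′ mixed scalar corners — sliver (S-int) «INTEGRABILITY OVER A SUBTYPE PRODUCT AT A REGULAR POINT» (F0P3a-p08 (g23) CLOSER PLAN 2026-09-02T12:32:00Z; LH3-plan (g4)).
-/
import Literature.NumberTheory.Rogawski1990.ArchFaceDescentTower    -- ★ p851446 (F0P3a-p08 (g23)): `isCompact_setOf_conj_gprimeBlockAt_mem`, `integrable_faceIntegrand` (the `Fin m` twin); brings `gprimeBlockAt`, `archLocal`, `locallyCompactSpace_archLocal`, `secondCountableTopology_archLocal`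
import HarnessLib

/-!
# (B3-JUNCTION, MIXED CORNER) Integrability of the conjugation readers over a SUBTYPE product `Π_{w : p w} G_w` at a regular point

Sub-problem `HC_CM` of `HodgeConjecture`, route `HCCMUnconditional`, crux H413 `stub_N9` (`stmt-HodgeConjecture-24833`), LH3 leaf `F0_P3c_StubN9Direct` v9, organ **O-L1d′-N**
(`stub_N9hcCentralMixedJetBoundsNormalised`, the `hCm` callback of ★ `smoothBounded_orbFamGExt_of_strata₄` at the `(0,2)`-normalised mixed corners): sliver **(S-int)** of
F0P3a-p08 (g23)'s O-L1d′-N closer «PKG-T (★ p851431) → `c`-cut-off → ★ `PiIntegralSumReindex` split + Fubini → ★ `exists_faceDescentTower` inside the `Z`-integral → dress → ★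
`…_of_mixedModel`».  The Fubini step over PKG-T's product `Π_{w : {w ∕∕ p w}} G_w` (the nc-singular compact-chart places of the base point, BEFORE the re-indexing
`{w ∕∕ p w} ≃ Fin m₂ ⊕ Fin m₁`) needs the integrability of the conjugation-reader integrand over the subtype product at a REGULAR coordinate `c`; this file is the SUBTYPE twin of
★ `integrable_faceIntegrand` (index `Fin m` ↦ `{w ∕∕ p w}`), same proof: the integrand `g ↦ F((↑↑(g_w · γ_w(c_w) · g_w⁻¹))_w)` is continuous, and it vanishes off the compact box
`Π_w {g ∈ G_w | ↑↑(g γ_w(c_w) g⁻¹) ∈ C}` (★ `isCompact_setOf_conj_gprimeBlockAt_mem` at each regular torus point; Mathlib `isCompact_univ_pi`), so it is integrable for the product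
Haar measure (`Continuous.integrable_of_hasCompactSupport`); `[NumberField L]` makes the set of complex places finite.  THEOREMS ONLY (no `def`, no instance, no notation, no axiom, no named fact, no `sorry`); lane
`--kind proof --supports stmt-HodgeConjecture-24833`; count-neutral.
HONEST LABEL: bookkeeping only; HC_CM is proved only modulo the 7 printed citations (2 remaining: hLiu418 = `stmt-HodgeConjecture-24832`, h413 = `stmt-HodgeConjecture-24833`)
until rung 0 closes; this file moves no row of the books.

## References
* [Rogawski1990] J. D. Rogawski, *Automorphic Representations of Unitary Groups in Three Variables*, Ann. of Math. Stud. 123 (1990), §8.2 p. 122 (the chart torus points).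
* [vanDoorn2021HaarMeasure] F. van Doorn, *Formalized Haar Measure*, ITP 2021, §4 Thm. 3 (product Haar measure), §7 (Fubini).
* [DeitmarEchterhoff2014] A. Deitmar, S. Echterhoff, *Principles of Harmonic Analysis*, 2nd ed. (2014), Lemma 9.3.3 (compact conjugating sets at regular points).
-/

set_option autoImplicit false

noncomputable section

open MeasureTheory MeasureTheory.Measure Set Function NumberField NumberField.InfinitePlace
open Literature.NumberTheory.Automorphic Literature.NumberTheory.Automorphic.UnitaryGroup
open scoped MatrixGroups Classical

namespace Literature.NumberTheory.Rogawski1990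

section Subtype

variable (L : Type) [Field L] [NumberField L] (α : Fin 3 → L) (S' : Finset {w : InfinitePlace L // IsComplex w})
  [∀ w : {w : InfinitePlace L // IsComplex w}, MeasurableSpace ↥(archLocal L 3 (Matrix.diagonal α) w)]
  [∀ w : {w : InfinitePlace L // IsComplex w}, BorelSpace ↥(archLocal L 3 (Matrix.diagonal α) w)]
  (ν : ∀ w : {w : InfinitePlace L // IsComplex w}, Measure ↥(archLocal L 3 (Matrix.diagonal α) w))

/-- **(S-int) INTEGRABILITY OF THE CONJUGATION READERS OVER A SUBTYPE PRODUCT AT A REGULAR POINT.**  For a decidable predicate `p` on the compact places selecting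
compact-chart places (`hp : p w → w ∉ S′`), Haar measures `ν_w` on the `G_w`, a continuous `F : ({w ∕∕ p w} → M₃(ℂ)) → E` vanishing as soon as one block leaves the compact `C`
(`hFC`), and a coordinate `c` REGULAR at every selected place (`hreg : i ↦ e^{i c_{w i}}` injective), the integrand `g ↦ F (w ↦ ↑↑(g_w · γ_w(c_w) · g_w⁻¹))`
(`γ_w = gprimeBlockAt L α w S′`) is integrable for `Measure.pi (w ↦ ν_w)` on `Π_{w : {w ∕∕ p w}} G_w` — the subtype twin of ★ `integrable_faceIntegrand` (continuous integrand with
support in the compact box `Π_w {g | ↑↑(g γ_w(c_w) g⁻¹) ∈ C}`, ★ `isCompact_setOf_conj_gprimeBlockAt_mem`, Mathlib `isCompact_univ_pi`, `Continuous.integrable_of_hasCompactSupport`).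
[cite: Rogawski1990, §8.2 p. 122] [cite: vanDoorn2021HaarMeasure, §4 Thm. 3; §7] [cite: DeitmarEchterhoff2014, Lemma 9.3.3] -/
theorem integrable_conjReaders_pi_subtype (hα : ∀ i, α i ≠ 0) [∀ w : {w : InfinitePlace L // IsComplex w}, (ν w).IsHaarMeasure]
    {E : Type} [NormedAddCommGroup E] (p : {w : InfinitePlace L // IsComplex w} → Prop) [DecidablePred p] (hp : ∀ w, p w → w ∉ S')
    (F : (({w : {w : InfinitePlace L // IsComplex w} // p w}) → Matrix (Fin 3) (Fin 3) ℂ) → E) (hF : Continuous F)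
    {C : Set (Matrix (Fin 3) (Fin 3) ℂ)} (hC : IsCompact C)
    (hFC : ∀ Y : {w : {w : InfinitePlace L // IsComplex w} // p w} → Matrix (Fin 3) (Fin 3) ℂ, (∃ w, Y w ∉ C) → F Y = 0)
    (c : {w : InfinitePlace L // IsComplex w} → Fin 3 → ℝ)
    (hreg : ∀ w : {w : {w : InfinitePlace L // IsComplex w} // p w}, Injective fun i : Fin 3 => Circle.exp (c w.1 i)) :
    Integrable (fun g : ((w : {w : {w : InfinitePlace L // IsComplex w} // p w}) → ↥(archLocal L 3 (Matrix.diagonal α) w.1)) =>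
        F (fun w => (((g w * gprimeBlockAt L α w.1 S' (c w.1) * (g w)⁻¹ : ↥(archLocal L 3 (Matrix.diagonal α) w.1)) : GL (Fin 3) ℂ) : Matrix (Fin 3) (Fin 3) ℂ)))
      (Measure.pi fun w : {w : {w : InfinitePlace L // IsComplex w} // p w} => ν w.1) := by
  haveI : ∀ w : {w : InfinitePlace L // IsComplex w}, LocallyCompactSpace (archLocal L 3 (Matrix.diagonal α) w) := fun w => locallyCompactSpace_archLocal L 3 (Matrix.diagonal α) w
  haveI : ∀ w : {w : InfinitePlace L // IsComplex w}, SecondCountableTopology (archLocal L 3 (Matrix.diagonal α) w) := fun w => secondCountableTopology_archLocal L 3 (Matrix.diagonal α) w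
  have hA : Continuous fun g : ((w : {w : {w : InfinitePlace L // IsComplex w} // p w}) → ↥(archLocal L 3 (Matrix.diagonal α) w.1)) => fun w =>
      (((g w * gprimeBlockAt L α w.1 S' (c w.1) * (g w)⁻¹ : ↥(archLocal L 3 (Matrix.diagonal α) w.1)) : GL (Fin 3) ℂ) : Matrix (Fin 3) (Fin 3) ℂ) :=
    continuous_pi fun w => (Units.continuous_val.comp continuous_subtype_val).comp ((((continuous_apply w).mul continuous_const)).mul (continuous_apply w).inv)
  refine (hF.comp hA).integrable_of_hasCompactSupport ?_
  have hS : ∀ w : {w : {w : InfinitePlace L // IsComplex w} // p w}, IsCompact {g : ↥(archLocal L 3 (Matrix.diagonal α) w.1) |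
      (((g * gprimeBlockAt L α w.1 S' (c w.1) * g⁻¹ : ↥(archLocal L 3 (Matrix.diagonal α) w.1)) : GL (Fin 3) ℂ) : Matrix (Fin 3) (Fin 3) ℂ) ∈ C} :=
    fun w => isCompact_setOf_conj_gprimeBlockAt_mem L α S' hα (hp w.1 w.2) (hreg w) hC
  refine HasCompactSupport.intro (isCompact_univ_pi hS) fun g hg => ?_
  simp only [mem_univ_pi, mem_setOf_eq, not_forall] at hg
  obtain ⟨w, hw⟩ := hg
  exact hFC _ ⟨w, hw⟩

end Subtype

end Literature.NumberTheory.Rogawski1990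

end
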